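import Summits.CriticalPhenomena.PercolationContinuityZ3.Theorems.PercNearOneGluingAdditiveGluingGDMReduction2
import Summits.CriticalPhenomena.PercolationContinuityZ3.Theorems.PercNearOneGluingAdditiveGluingExchangeCert
import HarnessLib

/-! # Crux `PercNearOneGluing.AdditiveGluing` (stmt-CriticalPhenomena-4576) — reduction of the crux to the SINGLE-COMPETITOR exchange
# certificate on the refined glued-dominant-minimiser class (exchange-certificate form, seat (d) round 3, third reduction)

Support file (`--supports stmt-CriticalPhenomena-4576`); no definitions, no named facts.  CONDITIONAL result (hypothesis spelled out).

Same case split as `cone7_of_gdmCert2` (isolated | `A.card ≤ 3` | leaf | pinned leaf | switch | pinned switch), but the residual class is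
discharged by the round-2 single-competitor exchange certificate `blockGood_of_exchange`: it suffices that SOME relay `a` satisfies
`V_a ≥ 0`, i.e. `μ(a↔b, a₀↮S) ≤ μ(S↔b, a₀↮S) + pockets` (no layers, no witness weightings, no `HBLK` in the certificate).  Census of this seat
(lab/t21, |A| ≥ 4, n = 6,7, 24 906 drift instances): the structural closures fail on 2 instances, both with `max_a V_a ≥ 0`; on every member of
the refined class found (incl. lead-c5's all-drift witness padded to |A| = 4) the bridging deletion-minimiser `a` has `V_a > 0`.
`additiveGluing_of_gdmExch : GDMEXCH → AdditiveGluing` (crux statement unfolded).  [cite: KozmaNitzan2024, §3.2 pp. 12–14, Lemma 3 pp. 6–7]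
-/

namespace Summit.CriticalPhenomena.PercolationContinuityZ3.Theorems

open MeasureTheory Set
open Literature.Probability.LatticeModels (prodBernoulli)
open Literature.Probability.Percolation (BondConfig openConn openConnIn openGraph openCluster)
open scoped BigOperators

noncomputable section
open Classical

section GDMExchangeReduction

open Literature.Probability.LatticeModels Literature.Probability.Percolation

variable {n : ℕ}

/-- **The cone statement from the single-competitor exchange certificate on the refined GDM class.**
[cite: KozmaNitzan2024, §3.2 Thms 4–5 pp. 12–14, Lemma 3 pp. 6–7] -/
theorem cone7_of_gdmExch
    (hG : (∀ (n : ℕ) (u : Sym2 (Fin n) → unitInterval) (A S : Finset (Fin n)) (b a₀ : Fin n) (hb : b ∈ A),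
      Disjoint S A → a₀ ∈ A →
      (∀ a ∈ A, (prodBernoulli u).real (openConn a₀ b) ≤ (prodBernoulli u).real (openConn a b)) →
      (∀ w' : Sym2 (Fin n) → unitInterval,
        (Finset.univ.filter (fun v : Fin n => ∃ y : Fin n, 0 < (w' s(y, v) : ℝ))).card
          < (Finset.univ.filter (fun v : Fin n => ∃ y : Fin n, 0 < (u s(y, v) : ℝ))).card →
        ∀ (A' S' : Finset (Fin n)) (b' d' : Fin n) (hb' : b' ∈ A'), Disjoint S' A' → d' ∈ A' →
        (∀ a ∈ A', (prodBernoulli w').real (openConn d' b') ≤ (prodBernoulli w').real (openConn a b')) →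
        (prodBernoulli w').real (openConn d' b')
          + (prodBernoulli w').real
              ((openConn d' b')ᶜ ∩ (⋃ v ∈ S', openConn d' v) ∩ (⋃ v ∈ S', openConn v b'))
        ≤ (prodBernoulli w').real (⋃ v ∈ S', openConn v b')
          + (∑ W ∈ (Finset.univ : Finset (Finset (Fin n))).filter (fun W => Disjoint W A'),
              (prodBernoulli w').real
                  {ω : BondConfig (Fin n) | ∀ z : Fin n, (z ∈ W ↔ ω ∈ ⋃ v ∈ S', openConn v z)}
                * A'.inf' ⟨b', hb'⟩ (fun a => (prodBernoulli w').real (openConnIn ((W : Set (Fin n))ᶜ) a b')))) →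
      4 ≤ A.card →
      (∃ x ∈ S, ∃ y : Fin n, (u s(x, y) : ℝ) ≠ 0) →
      (∀ v ∈ S, (prodBernoulli u).real (openConn v b) < (prodBernoulli u).real (openConn a₀ b)) →
      (∀ v ∈ S, (prodBernoulli (fun e : Sym2 (Fin n) => if a₀ ∈ e ∧ (∃ y ∈ e, y ∈ S) then (0 : unitInterval) else u e)).real (openConn v b) < (prodBernoulli (fun e : Sym2 (Fin n) => if a₀ ∈ e ∧ (∃ y ∈ e, y ∈ S) then (0 : unitInterval) else u e)).real (openConn a₀ b)) →
      (∀ x' ∈ S, (∃ y : Fin n, (u s(x', y) : ℝ) ≠ 0) → ∀ dd ∈ A,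
        (∀ a ∈ A, (prodBernoulli (fun e : Sym2 (Fin n) => if (∃ y ∈ e, y ∈ ({x'} : Finset (Fin n))) then (0 : unitInterval) else u e)).real (openConn dd b) ≤ (prodBernoulli (fun e : Sym2 (Fin n) => if (∃ y ∈ e, y ∈ ({x'} : Finset (Fin n))) then (0 : unitInterval) else u e)).real (openConn a b)) →
        (prodBernoulli (fun e : Sym2 (Fin n) => if (∀ y ∈ e, y ∈ S) ∧ ¬ e.IsDiag then 1 else u e)).real (openConn dd b) < (prodBernoulli (fun e : Sym2 (Fin n) => if (∀ y ∈ e, y ∈ S) ∧ ¬ e.IsDiag then 1 else u e)).real (openConn a₀ b)) →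
      (∀ x' ∈ S, (∃ y : Fin n, ((fun e : Sym2 (Fin n) => if a₀ ∈ e ∧ (∃ y ∈ e, y ∈ S) then (0 : unitInterval) else u e) s(x', y) : ℝ) ≠ 0) → ∀ dd ∈ A,
        (∀ a ∈ A, (prodBernoulli (fun e : Sym2 (Fin n) => if (∃ y ∈ e, y ∈ ({x'} : Finset (Fin n))) then (0 : unitInterval) else (fun e : Sym2 (Fin n) => if a₀ ∈ e ∧ (∃ y ∈ e, y ∈ S) then (0 : unitInterval) else u e) e)).real (openConn dd b) ≤ (prodBernoulli (fun e : Sym2 (Fin n) => if (∃ y ∈ e, y ∈ ({x'} : Finset (Fin n))) then (0 : unitInterval) else (fun e : Sym2 (Fin n) => if a₀ ∈ e ∧ (∃ y ∈ e, y ∈ S) then (0 : unitInterval) else u e) e)).real (openConn a b)) →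
        (prodBernoulli (fun e : Sym2 (Fin n) => if (∀ y ∈ e, y ∈ S) ∧ ¬ e.IsDiag then 1 else (fun e : Sym2 (Fin n) => if a₀ ∈ e ∧ (∃ y ∈ e, y ∈ S) then (0 : unitInterval) else u e) e)).real (openConn dd b) < (prodBernoulli (fun e : Sym2 (Fin n) => if (∀ y ∈ e, y ∈ S) ∧ ¬ e.IsDiag then 1 else (fun e : Sym2 (Fin n) => if a₀ ∈ e ∧ (∃ y ∈ e, y ∈ S) then (0 : unitInterval) else u e) e)).real (openConn a₀ b)) →
      ∃ a ∈ A, (prodBernoulli u).real (openConn a b ∩ (⋃ s ∈ S, openConn a₀ s)ᶜ)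
      ≤ (prodBernoulli u).real ((⋃ s ∈ S, openConn s b) ∩ (⋃ s ∈ S, openConn a₀ s)ᶜ)
        + ∑ W ∈ (Finset.univ : Finset (Finset (Fin n))).filter (fun W => Disjoint W A),
            (prodBernoulli u).real {ω : BondConfig (Fin n) | ∀ z : Fin n, (z ∈ W ↔ ω ∈ ⋃ s ∈ S, openConn s z)}
              * A.inf' ⟨b, hb⟩ (fun a' => (prodBernoulli u).real (openConnIn ((W : Set (Fin n))ᶜ) a' b)))) :
    ∀ (n : ℕ) (u : Sym2 (Fin n) → unitInterval) (A S : Finset (Fin n)) (b a₀ : Fin n) (hb : b ∈ A),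
      Disjoint S A → a₀ ∈ A →
      (∀ a ∈ A, (prodBernoulli u).real (openConn a₀ b) ≤ (prodBernoulli u).real (openConn a b)) →
      (∀ w' : Sym2 (Fin n) → unitInterval,
        (Finset.univ.filter (fun v : Fin n => ∃ y : Fin n, 0 < (w' s(y, v) : ℝ))).card
          < (Finset.univ.filter (fun v : Fin n => ∃ y : Fin n, 0 < (u s(y, v) : ℝ))).card →
        ∀ (A' S' : Finset (Fin n)) (b' d' : Fin n) (hb' : b' ∈ A'), Disjoint S' A' → d' ∈ A' →
        (∀ a ∈ A', (prodBernoulli w').real (openConn d' b') ≤ (prodBernoulli w').real (openConn a b')) →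
        (prodBernoulli w').real (openConn d' b')
          + (prodBernoulli w').real
              ((openConn d' b')ᶜ ∩ (⋃ v ∈ S', openConn d' v) ∩ (⋃ v ∈ S', openConn v b'))
        ≤ (prodBernoulli w').real (⋃ v ∈ S', openConn v b')
          + (∑ W ∈ (Finset.univ : Finset (Finset (Fin n))).filter (fun W => Disjoint W A'),
              (prodBernoulli w').real
                  {ω : BondConfig (Fin n) | ∀ z : Fin n, (z ∈ W ↔ ω ∈ ⋃ v ∈ S', openConn v z)}
                * A'.inf' ⟨b', hb'⟩ (fun a => (prodBernoulli w').real (openConnIn ((W : Set (Fin n))ᶜ) a b')))) →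
      (prodBernoulli u).real (openConn a₀ b)
          + (prodBernoulli u).real
              ((openConn a₀ b)ᶜ ∩ (⋃ v ∈ S, openConn a₀ v) ∩ (⋃ v ∈ S, openConn v b))
        ≤ (prodBernoulli u).real (⋃ v ∈ S, openConn v b)
          + (∑ W ∈ (Finset.univ : Finset (Finset (Fin n))).filter (fun W => Disjoint W A),
              (prodBernoulli u).real
                  {ω : BondConfig (Fin n) | ∀ z : Fin n, (z ∈ W ↔ ω ∈ ⋃ v ∈ S, openConn v z)}
                * A.inf' ⟨b, hb⟩ (fun a => (prodBernoulli u).real (openConnIn ((W : Set (Fin n))ᶜ) a b))) := by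
  intro n u A S b a₀ hb hSA ha₀ hmin hblk
  have hbS : b ∉ S := fun h => Finset.disjoint_left.1 hSA h hb
  -- isolated block
  by_cases hiso : ∀ v ∈ S, ∀ y : Fin n, (u s(y, v) : ℝ) = 0
  · exact stub_isolatedBlock_c5 n u A S b a₀ hb hSA ha₀ hmin hiso
  have hex : ∃ x ∈ S, ∃ y : Fin n, (u s(x, y) : ℝ) ≠ 0 := by
    push Not at hiso
    obtain ⟨v, hv, y, hy⟩ := hiso
    refine ⟨v, hv, y, ?_⟩
    rw [Sym2.eq_swap]
    exact hy
  have hSne : S.Nonempty := by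
    obtain ⟨x, hx, -⟩ := hex
    exact ⟨x, hx⟩
  -- at most two relays besides the target
  by_cases hA3 : A.card ≤ 3
  · exact blockGood_cardLeThree_inf u A S b a₀ hb ha₀ hA3 hSne hmin
  have hA4 : 4 ≤ A.card := by omega
  -- leaf
  by_cases hleaf : ∃ v ∈ S, (prodBernoulli u).real (openConn a₀ b) ≤ (prodBernoulli u).real (openConn v b)
  · obtain ⟨v, hv, hle⟩ := hleaf
    exact blockGood_of_leaf u A S b a₀ v hb hv hbS hle
  -- pinned leaf
  by_cases hpleaf : ∃ v ∈ S, (prodBernoulli (fun e : Sym2 (Fin n) => if a₀ ∈ e ∧ (∃ y ∈ e, y ∈ S) then (0 : unitInterval) else u e)).real (openConn a₀ b) ≤ (prodBernoulli (fun e : Sym2 (Fin n) => if a₀ ∈ e ∧ (∃ y ∈ e, y ∈ S) then (0 : unitInterval) else u e)).real (openConn v b)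
  · obtain ⟨v, hv, hle⟩ := hpleaf
    exact blockGood_of_pinnedLeaf u A S b a₀ v hb hSA ha₀ hv hle
  -- switch
  by_cases hsw : ∃ x' ∈ S, (∃ y : Fin n, (u s(x', y) : ℝ) ≠ 0) ∧ ∃ d ∈ A,
      (∀ a ∈ A, (prodBernoulli (fun e : Sym2 (Fin n) => if (∃ y ∈ e, y ∈ ({x'} : Finset (Fin n))) then (0 : unitInterval) else u e)).real (openConn d b) ≤ (prodBernoulli (fun e : Sym2 (Fin n) => if (∃ y ∈ e, y ∈ ({x'} : Finset (Fin n))) then (0 : unitInterval) else u e)).real (openConn a b)) ∧ (prodBernoulli (fun e : Sym2 (Fin n) => if (∀ y ∈ e, y ∈ S) ∧ ¬ e.IsDiag then 1 else u e)).real (openConn a₀ b) ≤ (prodBernoulli (fun e : Sym2 (Fin n) => if (∀ y ∈ e, y ∈ S) ∧ ¬ e.IsDiag then 1 else u e)).real (openConn d b)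
  · obtain ⟨x', hx', hy, d, hd, hdmin, hle⟩ := hsw
    exact blockGood_of_switch u A S b a₀ x' d hb hSA hx' hd hy hdmin hle hblk
  -- pinned switch
  by_cases hpsw : ∃ x' ∈ S, (∃ y : Fin n, ((fun e : Sym2 (Fin n) => if a₀ ∈ e ∧ (∃ y ∈ e, y ∈ S) then (0 : unitInterval) else u e) s(x', y) : ℝ) ≠ 0) ∧ ∃ d ∈ A,
      (∀ a ∈ A, (prodBernoulli (fun e : Sym2 (Fin n) => if (∃ y ∈ e, y ∈ ({x'} : Finset (Fin n))) then (0 : unitInterval) else (fun e : Sym2 (Fin n) => if a₀ ∈ e ∧ (∃ y ∈ e, y ∈ S) then (0 : unitInterval) else u e) e)).real (openConn d b) ≤ (prodBernoulli (fun e : Sym2 (Fin n) => if (∃ y ∈ e, y ∈ ({x'} : Finset (Fin n))) then (0 : unitInterval) else (fun e : Sym2 (Fin n) => if a₀ ∈ e ∧ (∃ y ∈ e, y ∈ S) then (0 : unitInterval) else u e) e)).real (openConn a b)) ∧ (prodBernoulli (fun e : Sym2 (Fin n) => if (∀ y ∈ e, y ∈ S) ∧ ¬ e.IsDiag then 1 else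 (fun e : Sym2 (Fin n) => if a₀ ∈ e ∧ (∃ y ∈ e, y ∈ S) then (0 : unitInterval) else u e) e)).real (openConn a₀ b) ≤ (prodBernoulli (fun e : Sym2 (Fin n) => if (∀ y ∈ e, y ∈ S) ∧ ¬ e.IsDiag then 1 else (fun e : Sym2 (Fin n) => if a₀ ∈ e ∧ (∃ y ∈ e, y ∈ S) then (0 : unitInterval) else u e) e)).real (openConn d b)
  · obtain ⟨x', hx', hy, d, hd, hdmin, hle⟩ := hpsw
    exact blockGood_of_pinnedSwitch u A S b a₀ x' d hb hSA ha₀ hx' hd hy hdmin hle hblk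
  -- the refined glued-dominant-minimiser class: use the certificate
  have hbad : ∀ v ∈ S, (prodBernoulli u).real (openConn v b) < (prodBernoulli u).real (openConn a₀ b) := by
    intro v hv
    by_contra h
    exact hleaf ⟨v, hv, not_lt.1 h⟩
  have hpbad : ∀ v ∈ S, (prodBernoulli (fun e : Sym2 (Fin n) => if a₀ ∈ e ∧ (∃ y ∈ e, y ∈ S) then (0 : unitInterval) else u e)).real (openConn v b) < (prodBernoulli (fun e : Sym2 (Fin n) => if a₀ ∈ e ∧ (∃ y ∈ e, y ∈ S) then (0 : unitInterval) else u e)).real (openConn a₀ b) := by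
    intro v hv
    by_contra h
    exact hpleaf ⟨v, hv, not_lt.1 h⟩
  have hgdm : ∀ x' ∈ S, (∃ y : Fin n, (u s(x', y) : ℝ) ≠ 0) → ∀ dd ∈ A,
      (∀ a ∈ A, (prodBernoulli (fun e : Sym2 (Fin n) => if (∃ y ∈ e, y ∈ ({x'} : Finset (Fin n))) then (0 : unitInterval) else u e)).real (openConn dd b) ≤ (prodBernoulli (fun e : Sym2 (Fin n) => if (∃ y ∈ e, y ∈ ({x'} : Finset (Fin n))) then (0 : unitInterval) else u e)).real (openConn a b)) →
      (prodBernoulli (fun e : Sym2 (Fin n) => if (∀ y ∈ e, y ∈ S) ∧ ¬ e.IsDiag then 1 else u e)).real (openConn dd b) < (prodBernoulli (fun e : Sym2 (Fin n) => if (∀ y ∈ e, y ∈ S) ∧ ¬ e.IsDiag then 1 else u e)).real (openConn a₀ b) := by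
    intro x' hx' hy dd hdd hddmin
    by_contra h
    exact hsw ⟨x', hx', hy, dd, hdd, hddmin, not_lt.1 h⟩
  have hpgdm : ∀ x' ∈ S, (∃ y : Fin n, ((fun e : Sym2 (Fin n) => if a₀ ∈ e ∧ (∃ y ∈ e, y ∈ S) then (0 : unitInterval) else u e) s(x', y) : ℝ) ≠ 0) → ∀ dd ∈ A,
      (∀ a ∈ A, (prodBernoulli (fun e : Sym2 (Fin n) => if (∃ y ∈ e, y ∈ ({x'} : Finset (Fin n))) then (0 : unitInterval) else (fun e : Sym2 (Fin n) => if a₀ ∈ e ∧ (∃ y ∈ e, y ∈ S) then (0 : unitInterval) else u e) e)).real (openConn dd b) ≤ (prodBernoulli (fun e : Sym2 (Fin n) => if (∃ y ∈ e, y ∈ ({x'} : Finset (Fin n))) then (0 : unitInterval) else (fun e : Sym2 (Fin n) => if a₀ ∈ e ∧ (∃ y ∈ e, y ∈ S) then (0 : unitInterval) else u e) e)).real (openConn a b)) →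
      (prodBernoulli (fun e : Sym2 (Fin n) => if (∀ y ∈ e, y ∈ S) ∧ ¬ e.IsDiag then 1 else (fun e : Sym2 (Fin n) => if a₀ ∈ e ∧ (∃ y ∈ e, y ∈ S) then (0 : unitInterval) else u e) e)).real (openConn dd b) < (prodBernoulli (fun e : Sym2 (Fin n) => if (∀ y ∈ e, y ∈ S) ∧ ¬ e.IsDiag then 1 else (fun e : Sym2 (Fin n) => if a₀ ∈ e ∧ (∃ y ∈ e, y ∈ S) then (0 : unitInterval) else u e) e)).real (openConn a₀ b) := by
    intro x' hx' hy dd hdd hddmin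
    by_contra h
    exact hpsw ⟨x', hx', hy, dd, hdd, hddmin, not_lt.1 h⟩
  obtain ⟨a, ha, hV⟩ := hG n u A S b a₀ hb hSA ha₀ hmin hblk hA4 hex hbad hpbad hgdm hpgdm
  exact blockGood_of_exchange u A S b a₀ a hb hSne (hmin a ha) hV

/-- **`AdditiveGluing` from the single-competitor exchange certificate on the refined GDM class** (crux statement unfolded; via
`stub_cone7Assembly_c5`). [cite: KozmaNitzan2024, §3.2 pp. 12–14] -/
theorem additiveGluing_of_gdmExch
    (hG : (∀ (n : ℕ) (u : Sym2 (Fin n) → unitInterval) (A S : Finset (Fin n)) (b a₀ : Fin n) (hb : b ∈ A),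
      Disjoint S A → a₀ ∈ A →
      (∀ a ∈ A, (prodBernoulli u).real (openConn a₀ b) ≤ (prodBernoulli u).real (openConn a b)) →
      (∀ w' : Sym2 (Fin n) → unitInterval,
        (Finset.univ.filter (fun v : Fin n => ∃ y : Fin n, 0 < (w' s(y, v) : ℝ))).card
          < (Finset.univ.filter (fun v : Fin n => ∃ y : Fin n, 0 < (u s(y, v) : ℝ))).card →
        ∀ (A' S' : Finset (Fin n)) (b' d' : Fin n) (hb' : b' ∈ A'), Disjoint S' A' → d' ∈ A' →
        (∀ a ∈ A', (prodBernoulli w').real (openConn d' b') ≤ (prodBernoulli w').real (openConn a b')) →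
        (prodBernoulli w').real (openConn d' b')
          + (prodBernoulli w').real
              ((openConn d' b')ᶜ ∩ (⋃ v ∈ S', openConn d' v) ∩ (⋃ v ∈ S', openConn v b'))
        ≤ (prodBernoulli w').real (⋃ v ∈ S', openConn v b')
          + (∑ W ∈ (Finset.univ : Finset (Finset (Fin n))).filter (fun W => Disjoint W A'),
              (prodBernoulli w').real
                  {ω : BondConfig (Fin n) | ∀ z : Fin n, (z ∈ W ↔ ω ∈ ⋃ v ∈ S', openConn v z)}
                * A'.inf' ⟨b', hb'⟩ (fun a => (prodBernoulli w').real (openConnIn ((W : Set (Fin n))ᶜ) a b')))) →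
      4 ≤ A.card →
      (∃ x ∈ S, ∃ y : Fin n, (u s(x, y) : ℝ) ≠ 0) →
      (∀ v ∈ S, (prodBernoulli u).real (openConn v b) < (prodBernoulli u).real (openConn a₀ b)) →
      (∀ v ∈ S, (prodBernoulli (fun e : Sym2 (Fin n) => if a₀ ∈ e ∧ (∃ y ∈ e, y ∈ S) then (0 : unitInterval) else u e)).real (openConn v b) < (prodBernoulli (fun e : Sym2 (Fin n) => if a₀ ∈ e ∧ (∃ y ∈ e, y ∈ S) then (0 : unitInterval) else u e)).real (openConn a₀ b)) →
      (∀ x' ∈ S, (∃ y : Fin n, (u s(x', y) : ℝ) ≠ 0) → ∀ dd ∈ A,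
        (∀ a ∈ A, (prodBernoulli (fun e : Sym2 (Fin n) => if (∃ y ∈ e, y ∈ ({x'} : Finset (Fin n))) then (0 : unitInterval) else u e)).real (openConn dd b) ≤ (prodBernoulli (fun e : Sym2 (Fin n) => if (∃ y ∈ e, y ∈ ({x'} : Finset (Fin n))) then (0 : unitInterval) else u e)).real (openConn a b)) →
        (prodBernoulli (fun e : Sym2 (Fin n) => if (∀ y ∈ e, y ∈ S) ∧ ¬ e.IsDiag then 1 else u e)).real (openConn dd b) < (prodBernoulli (fun e : Sym2 (Fin n) => if (∀ y ∈ e, y ∈ S) ∧ ¬ e.IsDiag then 1 else u e)).real (openConn a₀ b)) →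
      (∀ x' ∈ S, (∃ y : Fin n, ((fun e : Sym2 (Fin n) => if a₀ ∈ e ∧ (∃ y ∈ e, y ∈ S) then (0 : unitInterval) else u e) s(x', y) : ℝ) ≠ 0) → ∀ dd ∈ A,
        (∀ a ∈ A, (prodBernoulli (fun e : Sym2 (Fin n) => if (∃ y ∈ e, y ∈ ({x'} : Finset (Fin n))) then (0 : unitInterval) else (fun e : Sym2 (Fin n) => if a₀ ∈ e ∧ (∃ y ∈ e, y ∈ S) then (0 : unitInterval) else u e) e)).real (openConn dd b) ≤ (prodBernoulli (fun e : Sym2 (Fin n) => if (∃ y ∈ e, y ∈ ({x'} : Finset (Fin n))) then (0 : unitInterval) else (fun e : Sym2 (Fin n) => if a₀ ∈ e ∧ (∃ y ∈ e, y ∈ S) then (0 : unitInterval) else u e) e)).real (openConn a b)) →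
        (prodBernoulli (fun e : Sym2 (Fin n) => if (∀ y ∈ e, y ∈ S) ∧ ¬ e.IsDiag then 1 else (fun e : Sym2 (Fin n) => if a₀ ∈ e ∧ (∃ y ∈ e, y ∈ S) then (0 : unitInterval) else u e) e)).real (openConn dd b) < (prodBernoulli (fun e : Sym2 (Fin n) => if (∀ y ∈ e, y ∈ S) ∧ ¬ e.IsDiag then 1 else (fun e : Sym2 (Fin n) => if a₀ ∈ e ∧ (∃ y ∈ e, y ∈ S) then (0 : unitInterval) else u e) e)).real (openConn a₀ b)) →
      ∃ a ∈ A, (prodBernoulli u).real (openConn a b ∩ (⋃ s ∈ S, openConn a₀ s)ᶜ)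
      ≤ (prodBernoulli u).real ((⋃ s ∈ S, openConn s b) ∩ (⋃ s ∈ S, openConn a₀ s)ᶜ)
        + ∑ W ∈ (Finset.univ : Finset (Finset (Fin n))).filter (fun W => Disjoint W A),
            (prodBernoulli u).real {ω : BondConfig (Fin n) | ∀ z : Fin n, (z ∈ W ↔ ω ∈ ⋃ s ∈ S, openConn s z)}
              * A.inf' ⟨b, hb⟩ (fun a' => (prodBernoulli u).real (openConnIn ((W : Set (Fin n))ᶜ) a' b)))) :
    ∀ (n : ℕ) (w : Sym2 (Fin n) → unitInterval) (A : Finset (Fin n)) (o b : Fin n) (t : ℝ), 0 ≤ t →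
      (∀ a ∈ A, 1 - t ≤ (prodBernoulli w).real (openConn a b)) →
      (prodBernoulli w).real (⋃ a ∈ A, openConn o a) - t ≤ (prodBernoulli w).real (openConn o b) :=
  stub_cone7Assembly_c5 (cone7_of_gdmExch hG)

end GDMExchangeReduction

end

end Summit.CriticalPhenomena.PercolationContinuityZ3.Theorems
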